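import Summits.MatrixMultiplication.MatrixMultiplication.Theses.DesignFlattening
import Summits.MatrixMultiplication.MatrixMultiplication.Theses.WindowedCompletionRank

/-!
# Crux `GrowingHostDesigns` (stmt-MatrixMultiplication-8033) — `Lines/window-transfer.lean`

Strategist line `window-transfer` (lens: TRANSFER). The single-block case of the target
`GrowingHostDesigns` (X) of route DesignFlattening IS the window-frame crux of the sibling route
WindowedCompletionRank: `WindowCompletion` (stmt-MatrixMultiplication-5495: for every `ε > 0` some
`n ≥ 2`, finite abelian `G` with `|G| ≤ n^{2+ε}`, Cohn–Umans maps `A B C : [n] → G` and a completion `S`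
with `R(S) ≤ n^ε` and `⟨n,n,n⟩ = [αb + βc = γa] · S(γa, αb, βc)` on the nose).

* `stub_windowCompletion` — `WindowCompletion` BY NAME (open, difficulty open-problem; staffed on route
  WindowedCompletionRank; killed by that route's open negative crux `WindowSqrtBarrier`, stmt-5493,
  via the refuter's landed-as-evidence `WindowSqrtBarrier → ¬ WindowCompletion`).
* `stub_transfer` — PROVED HERE (no `sorry`): `WindowCompletion → GrowingHostDesigns`.  Mask `S` by the
  images of the three index maps (`S_X := (1_{im γ} ⊗ 1_{im α} ⊗ 1_{im β}) ∘ S`, a diagonal restriction,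
  `R(S_X) ≤ R(S)`); on the addition graph `S_X` is `{0,1}`-valued by the window equation, so with
  `P := {(u,v) | S_X(u+v;u,v) = 1}` the punctured table `[u+v = g ∧ (u,v) ∈ P]` equals
  `[u+v = g] · S_X` entrywise and hosts `1 ⊙ ⟨n,n,n⟩` on the nose through `(γ, α, β)`; `p = 1`, `N = 1`,
  `m = n`, cost `|G| · R(S_X) ≤ n^{2+η/2} · n^{η/2} = (1 · n^{2+η})^1` (invoke the stub at `ε := η/2`).

Why this line: it settles the TRANSFER heading of the strategist census — X at `p = 1` is not a new
statement but stmt-5495 (conversely every `p = 1`, `N = 1` instance of X is a window completion, and `N`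
collapses: powers of instances are instances) — so the lead should not spend cycles on single-block
families beyond what WindowedCompletionRank already staffs (line `birth` = the tight square host = WCR's
canonical full window `[p₂ + q₁ = 0]`, cf. `InvariantSqrtBound`), and the RESIDUAL content of X is the
multi-block regime `p ≥ m^{1−2η}` forced by `WindowSqrtBarrier` (line `toric-punctures`).

`GrowingHostDesigns_of` is modus ponens; the only `sorry` is `stub_windowCompletion`.
-/

set_option linter.dupNamespace false

namespace Summit.MatrixMultiplication.MatrixMultiplication.Cruxes.GrowingHostDesigns.WindowTransfer

open Summit.MatrixMultiplication.MatrixMultiplication.Theses.DesignFlattening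
open Literature.Computability.AlgebraicComplexity
open scoped BigOperators

/-- STUB 1 — the window-frame crux of route WindowedCompletionRank, BY NAME (stmt-MatrixMultiplication-5495;
open-problem; its negation follows from the open negative crux `WindowSqrtBarrier`, stmt-5493). -/
theorem stub_windowCompletion :
    Summit.MatrixMultiplication.MatrixMultiplication.Theses.WindowedCompletionRank.WindowCompletion := by
  sorry

/-- STUB 2 — the transfer, PROVED (size M): `WindowCompletion → GrowingHostDesigns` by masking the window
completion with the images of the index maps (`p = 1`, `N = 1`, `m = n`, `ε := η/2`). -/
theorem stub_transfer :
    Summit.MatrixMultiplication.MatrixMultiplication.Theses.WindowedCompletionRank.WindowCompletion →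
      GrowingHostDesigns := by
  intro hWC
  classical
  intro η hη
  obtain ⟨n, hn, G, iG, iF, iD, hcard, A, B, C, S, hRS, hwin⟩ := hWC (η / 2) (by positivity)
  -- the three index maps of X (a-leg `αX = γ`, b-leg `βX = α`, c-leg `γX = β` of the window frame)
  set αX : Fin n × Fin n → G := fun a => A a.1 + C a.2 with hαX
  set βX : Fin n × Fin n → G := fun b => A b.1 - B b.2 with hβX
  set γX : Fin n × Fin n → G := fun c => B c.1 + C c.2 with hγX
  have hw : ∀ (a b c : Fin n × Fin n), matMulTensor ℂ n n n a b c =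
      if βX b + γX c = αX a then S (αX a) (βX b) (γX c) else 0 := fun a b c =>
    congrFun (congrFun (congrFun hwin a) b) c
  have hmm01 : ∀ (a b c : Fin n × Fin n),
      matMulTensor ℂ n n n a b c = 0 ∨ matMulTensor ℂ n n n a b c = 1 := by
    intro a b c
    unfold matMulTensor
    split_ifs <;> simp
  -- the masked completion
  set SX : G → G → G → ℂ := fun g u v =>
      (if ∃ a, αX a = g then (1 : ℂ) else 0) * (if ∃ b, βX b = u then (1 : ℂ) else 0) *
        (if ∃ c, γX c = v then (1 : ℂ) else 0) * S g u v with hSX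
  have hSX01 : ∀ u v : G, SX (u + v) u v = 0 ∨ SX (u + v) u v = 1 := by
    intro u v
    simp only [hSX]
    by_cases hA : ∃ a, αX a = u + v
    · by_cases hB : ∃ b, βX b = u
      · by_cases hC : ∃ c, γX c = v
        · rw [if_pos hA, if_pos hB, if_pos hC]
          obtain ⟨a, ha⟩ := hA
          obtain ⟨b, hb⟩ := hB
          obtain ⟨c, hc⟩ := hC
          have hcond : βX b + γX c = αX a := by rw [ha, hb, hc]
          have hwabc := hw a b c
          rw [if_pos hcond, ha, hb, hc] at hwabc
          rw [← hwabc]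
          rcases hmm01 a b c with h0 | h1
          · left; rw [h0]; ring
          · right; rw [h1]; ring
        · left; rw [if_neg hC]; ring
      · left; rw [if_neg hB]; ring
    · left; rw [if_neg hA]; ring
  -- the kept-cell set
  set P : Finset (G × G) := Finset.univ.filter fun uv => SX (uv.1 + uv.2) uv.1 uv.2 = 1 with hP
  have hmemP : ∀ u v : G, (u, v) ∈ P ↔ SX (u + v) u v = 1 := by
    intro u v
    rw [hP, Finset.mem_filter]
    simp
  -- the punctured table is the full table times the masked completion, entrywise
  have hTP : ∀ g u v : G, (if u + v = g ∧ (u, v) ∈ P then (1 : ℂ) else 0) =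
      (if u + v = g then (1 : ℂ) else 0) * SX g u v := by
    intro g u v
    by_cases h : u + v = g
    · subst h
      rcases hSX01 u v with h0 | h1
      · rw [h0, mul_zero, if_neg]
        rintro ⟨_, hm⟩
        rw [hmemP, h0] at hm
        exact zero_ne_one hm
      · rw [h1, mul_one, if_pos ⟨rfl, (hmemP u v).2 h1⟩, if_pos rfl]
    · rw [if_neg (fun hh => h hh.1), if_neg h, zero_mul]
  -- the N = 1 completion
  set S' : (Fin 1 → G) → (Fin 1 → G) → (Fin 1 → G) → ℂ := fun a b c => SX (a 0) (b 0) (c 0) with hS'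
  -- rank: `S'` is a restriction of `SX`, which is a restriction of `S` (diagonal masks)
  have hres1 : TensorRestrictsTo S SX := by
    refine ⟨fun a' a => if a = a' then (if ∃ x, αX x = a' then (1 : ℂ) else 0) else 0,
      fun b' b => if b = b' then (if ∃ y, βX y = b' then (1 : ℂ) else 0) else 0,
      fun c' c => if c = c' then (if ∃ z, γX z = c' then (1 : ℂ) else 0) else 0, fun a' b' c' => ?_⟩
    rw [Finset.sum_eq_single a' (fun a _ ha => by simp [ha]) (by simp),
      Finset.sum_eq_single b' (fun b _ hb => by simp [hb]) (by simp),
      Finset.sum_eq_single c' (fun c _ hc => by simp [hc]) (by simp)]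
    simp only [hSX, if_true]
  have hres2 : TensorRestrictsTo SX S' :=
    tensorRestrictsTo_precomp SX (fun a : Fin 1 → G => a 0) (fun b : Fin 1 → G => b 0)
      (fun c : Fin 1 → G => c 0)
  have hrank : tensorRank S' ≤ tensorRank S := hres2.tensorRank_le.trans hres1.tensorRank_le
  refine ⟨G, iG, iF, iD, P, 1, n, 1, le_rfl, hn, le_rfl,
    ⟨fun x => αX x.2, fun y => βX y.2, fun z => γX z.2, ?_⟩, S', ?_, ?_⟩
  · -- hosting on the nose (one block): the window equation, masks all equal to one on image cells
    rintro ⟨i, x⟩ ⟨j, y⟩ ⟨l, z⟩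
    have hj : i = j := Subsingleton.elim _ _
    have hl : i = l := Subsingleton.elim _ _
    subst hj
    subst hl
    rw [matMulDirectSum_block]
    dsimp only
    have hwxyz := hw x y z
    by_cases hs : βX y + γX z = αX x
    · rw [if_pos hs] at hwxyz
      have hm : (βX y, γX z) ∈ P ↔ S (αX x) (βX y) (γX z) = 1 := by
        rw [hmemP, hs]
        simp only [hSX]
        rw [if_pos ⟨x, rfl⟩, if_pos ⟨y, rfl⟩, if_pos ⟨z, rfl⟩]
        simp
      rcases hmm01 x y z with h0 | h1
      · rw [h0] at hwxyz ⊢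
        rw [if_neg]
        rintro ⟨_, hmem⟩
        rw [hm] at hmem
        rw [hmem] at hwxyz
        exact zero_ne_one hwxyz
      · rw [h1] at hwxyz ⊢
        rw [if_pos ⟨hs, hm.2 hwxyz.symm⟩]
    · rw [if_neg hs] at hwxyz
      rw [hwxyz, if_neg (fun hh => hs hh.1)]
  · -- the completion identity at N = 1
    intro a b c
    rw [kroneckerPow_apply, kroneckerPow_apply, Fin.prod_univ_one, Fin.prod_univ_one]
    exact hTP (a 0) (b 0) (c 0)
  · -- cost: |G| · R(S') ≤ n^{2+η/2} · n^{η/2} = (1 · n^{2+η})^1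
    have hn0 : (0 : ℝ) < (n : ℝ) := by exact_mod_cast (lt_of_lt_of_le (by norm_num) hn)
    have hR : (tensorRank S' : ℝ) ≤ (n : ℝ) ^ (η / 2) :=
      (Nat.cast_le.mpr hrank).trans hRS
    rw [pow_one, pow_one, Nat.cast_one, one_mul]
    calc (Fintype.card G : ℝ) * (tensorRank S' : ℝ)
        ≤ (n : ℝ) ^ (2 + η / 2) * (n : ℝ) ^ (η / 2) :=
          mul_le_mul hcard hR (Nat.cast_nonneg _) (Real.rpow_nonneg hn0.le _)
      _ = (n : ℝ) ^ (2 + η) := by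
          rw [← Real.rpow_add hn0]
          ring_nf


/-- COMPOSITION: modus ponens with the proved transfer — `GrowingHostDesigns` under the single registered
open hypothesis `WindowCompletion` (stmt-MatrixMultiplication-5495). -/
theorem GrowingHostDesigns_of
    (h₁ : Summit.MatrixMultiplication.MatrixMultiplication.Theses.WindowedCompletionRank.WindowCompletion) :
    GrowingHostDesigns :=
  stub_transfer h₁

/-- The crux from the registered stubs (sorry-dependence only through `stub_windowCompletion`). -/
theorem GrowingHostDesigns_of_stubs : GrowingHostDesigns :=
  GrowingHostDesigns_of stub_windowCompletion

end Summit.MatrixMultiplication.MatrixMultiplication.Cruxes.GrowingHostDesigns.WindowTransfer
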